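import Summits.AtomisticToContinuum.HydrodynamicLimit.Theorems.InformationPercolationEnginePercolationClosesChaosRevealedDefectAssembly
import Summits.AtomisticToContinuum.HydrodynamicLimit.Theorems.InformationPercolationEnginePercolationClosesChaosRevealedDictionary
import HarnessLib

/-!
# The collision half of the revealed-atom dictionary: `stub_atomCollisionDictionary : AtomCollisionDictionary`
(stub S8b of the line `equilibrium-forecast-chain-rule`, crux `InformationPercolationEngine.PercolationClosesChaos`,
stmt-AtomisticToContinuum-15178)

Support file (`--supports stmt-AtomisticToContinuum-15178`) proving the REGISTERED stub `stub_atomCollisionDictionary`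
(worker W8 of lead c3): the statement `AtomCollisionDictionary` of `…RevealedDefectAssembly.lean` (worker W6) — for two good
phase points `z, z'` with the same data `seqHistLE b c σ N Φ k q` there is a bijection `Θ` from the `q`-owned collision
triples of step `k` of `z` onto those of `z'`, preserving the ordered labels, with `2b`-close pre-collisional velocities and
`4b`-close kicks of the first member. Pure bookkeeping over the tree enumerators `nthCollisionTimeOf` / `nthPartnerOf` /
`nthRecordOf` on the good set (Gallagher–Saint-Raymond–Texier 2013 Prop. 4.1.1), in three layers:

* the window enumeration of ONE sphere `a` (worker W3's index correspondence `sum_filter_fst_eq_sum_range`, pointwise):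
  `winIdx` lists the indices `n < #(collision times of a in (0, (k+1)Δ])` with `kΔ < t_n` — literally the index list of
  `jumps b c σ N Φ (k + 1) a` (`jumps_succ_eq_map`); its members are exactly the step-`k` collision triples with first member
  `a` (`mem_collTriples_of_mem_winIdx`, `exists_mem_winIdx`), injectively in time; `winPos a t z` is the POSITION in the list
  of the collision of `a` at time `t`, `winTime a ℓ z` the time at position `ℓ` (`winPos_spec`, `winPos_eq_of_lt`, `winTime_winPos`);
* equal atoms (`jumps_eq_of_seqHistLE_eq`): a sphere starting the step in `q` has the same record LIST in `z` and `z'`, so the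
  `ℓ`-th step-`k` collision of `a` in `z'` has the same partner and the same bins of `a`'s pre- and post-velocity and of the
  partner's pre-velocity as the `ℓ`-th one in `z` (`atomTransfer`; `nthRecordOf` IS the mark `markOf` read off the
  post-collisional configuration, `nthRecordOf_preVel_eq`);
* the map `atomMap`: `Θ (t, i, j) = (t', i, j)`, `t'` the time of the equally-positioned step-`k` collision in `z'` of the
  member starting in `q` (`qMember`: `i` if it does, else `j`); `atomMap_spec` collects its properties (owned triple of `z'` —
  start cells agree, `startCell_eq_and_norm_sub_le_of_seqHistLE_eq`; same position; closeness by `norm_sub_le_of_velBin_eq`,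
  and when the `q`-member sits in the second slot `markOf_swap` exchanges the pre-velocities while momentum conservation
  `kick_fst_eq` makes the kick of `i` minus the kick of `j`); injectivity = same labels and position give the same time,
  surjectivity = the same construction from `z'` back to `z`.
-/

noncomputable section

open MeasureTheory Set Filter Topology
open scoped ENNReal BigOperators Classical
open Literature.Analysis.FluidPDE Literature.MathematicalPhysics.KineticTheory
open Literature.MathematicalPhysics.KineticTheory.VelocityBlindPlacement

namespace Summit.AtomisticToContinuum.HydrodynamicLimit.Theorems.EquilibriumForecastLine

/-! ## The window enumeration of one sphere -/

/-- Number of collisions of sphere `a` with times in `(0, (k+1)Δ]` (the count behind `jumps b c σ N Φ (k + 1) a`). -/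
def winCount (c σ : ℝ) (N : ℕ) (Φ : Flow σ N) (k : ℕ) (a : Fin (N + 1)) (z : Phase N) : ℕ :=
  Set.ncard (collisionTimesOf G3 (hsDiameter σ N) (fun t => Φ.flow t z) a ∩ Set.Ioc 0 (((k : ℝ) + 1) * stepLen c σ N))

/-- The INDEX LIST of the step-`k` collisions of sphere `a`: the indices `n < winCount` with `kΔ < t_n`, increasing
(the list mapped by `jumps b c σ N Φ (k + 1) a`, `jumps_succ_eq_map`). -/
def winIdx (c σ : ℝ) (N : ℕ) (Φ : Flow σ N) (k : ℕ) (a : Fin (N + 1)) (z : Phase N) : List ℕ :=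
  (List.range (winCount c σ N Φ k a z)).filter fun n => decide ((k : ℝ) * stepLen c σ N < Φ.nthCollisionTimeOf a n z)

/-- The REDUCED RECORD of the `n`-th collision of `a`: (partner label, bin of own pre-velocity, bin of own post-velocity,
bin of the partner's pre-velocity) — the entries of `jumps`. -/
def winRecord {σ : ℝ} {N : ℕ} (b : ℝ) (Φ : Flow σ N) (a : Fin (N + 1)) (z : Phase N) (n : ℕ) :
    Fin (N + 1) × Cell × Cell × Cell :=
  (Φ.nthPartnerOf a n z, velBin b (Φ.nthRecordOf a n z).preVel.1, velBin b (Φ.nthRecordOf a n z).postVel.1,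
    velBin b (Φ.nthRecordOf a n z).preVel.2)

/-- POSITION, in the index list `winIdx … a z`, of the collision of `a` at time `t` (`= length` if there is none). -/
def winPos (c σ : ℝ) (N : ℕ) (Φ : Flow σ N) (k : ℕ) (a : Fin (N + 1)) (t : ℝ) (z : Phase N) : ℕ :=
  (winIdx c σ N Φ k a z).findIdx fun n => decide (Φ.nthCollisionTimeOf a n z = t)

/-- TIME of the step-`k` collision of `a` at position `ℓ` of the index list (junk `t_0` beyond the list). -/
def winTime (c σ : ℝ) (N : ℕ) (Φ : Flow σ N) (k : ℕ) (a : Fin (N + 1)) (ℓ : ℕ) (z : Phase N) : ℝ :=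
  Φ.nthCollisionTimeOf a ((winIdx c σ N Φ k a z).getD ℓ 0) z

section Window

variable {σ : ℝ} {N : ℕ} (Φ : Flow σ N) {z : Phase N}

/-- ORIENTATION CONVENTION (definitional): the pre-collisional velocities of the `n`-th record of `a` ARE the velocity part
of the mark `markOf` of the ordered pair `(a, partner)` read off the post-collisional configuration at the `n`-th collision
time; likewise `(Φ.nthRecordOf a n z).postVel.1 = ((Φ.flow t_n z) a).2` holds by `rfl`. [folklore] -/
theorem nthRecordOf_preVel_eq (a : Fin (N + 1)) (n : ℕ) (z : Phase N) :
    (Φ.nthRecordOf a n z).preVel =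
      (markOf N (hsDiameter σ N) (Φ.flow (Φ.nthCollisionTimeOf a n z) z) a (Φ.nthPartnerOf a n z)).2 := rfl

/-- `jumps (k + 1) a` is the index list of step `k` mapped by the reduced record (`((k+1 : ℕ) : ℝ) - 1 = k`). [folklore] -/
theorem jumps_succ_eq_map (b c : ℝ) (k : ℕ) (a : Fin (N + 1)) (z : Phase N) :
    jumps b c σ N Φ (k + 1) a z = (winIdx c σ N Φ k a z).map (winRecord b Φ a z) := by
  simp only [jumps, winIdx, winCount, Nat.cast_succ, add_sub_cancel_right]
  rfl

/-- Membership in the index list. [folklore] -/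
theorem mem_winIdx {c : ℝ} {k : ℕ} {a : Fin (N + 1)} {n : ℕ} :
    n ∈ winIdx c σ N Φ k a z ↔
      n < winCount c σ N Φ k a z ∧ (k : ℝ) * stepLen c σ N < Φ.nthCollisionTimeOf a n z := by
  simp [winIdx, List.mem_filter, List.mem_range]

/-- **Listed indices are step-`k` collision triples `(t_n, a, partner)`** (good set, `0 < σ < 1/2`; window enumeration
`nthCollisionTimeOf_mem_window`, binary collisions `nthPartnerOf_eq`, symmetric contact `swap_mem_contactPairs_iff`).
[folklore] -/
theorem mem_collTriples_of_mem_winIdx (hz : z ∈ Φ.good) (hσ : 0 < σ) (hσ2 : σ < 2⁻¹) (c : ℝ) {k : ℕ} {a : Fin (N + 1)}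
    {n : ℕ} (hn : n ∈ winIdx c σ N Φ k a z) :
    (Φ.nthCollisionTimeOf a n z, a, Φ.nthPartnerOf a n z) ∈ collTriples Φ (stepWindow c σ N k) z := by
  have hG := Torus.isHardSphereRegular_geometry (d := Fin 3) ((hsDiameter_le hσ.le N).trans_lt hσ2)
  obtain ⟨hnJ, hkn⟩ := (mem_winIdx Φ).1 hn
  have hmem := Φ.nthCollisionTimeOf_mem_window hz a hnJ
  obtain ⟨l, hl⟩ := hmem.1
  have hil : (a, l) ∈ contactPairs G3 (hsDiameter σ N) (Φ.flow (Φ.nthCollisionTimeOf a n z) z) := by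
    rcases hl with h | h
    · exact h
    · exact (swap_mem_contactPairs_iff hG (p := (l, a))).2 h
  refine (mem_collTriples Φ hz (stepWindow_subset_Icc c σ N k)).2 ⟨⟨hkn, hmem.2.2⟩, ?_⟩
  show (a, Φ.nthPartnerOf a n z) ∈ _
  rw [Φ.nthPartnerOf_eq hz hil]
  exact hil

/-- **Every step-`k` collision triple with first member `a` is listed**: it is `(t_n, a, nthPartnerOf a n)` for some
`n ∈ winIdx … a z` (`exists_lt_ncard_nthCollisionTimeOf_eq`, `nthPartnerOf_eq`). [folklore] -/
theorem exists_mem_winIdx (hz : z ∈ Φ.good) {c : ℝ} (hc : 0 < c) (hσ : 0 < σ) {k : ℕ} {a p : Fin (N + 1)} {t : ℝ}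
    (he : (t, a, p) ∈ collTriples Φ (stepWindow c σ N k) z) :
    ∃ n ∈ winIdx c σ N Φ k a z, Φ.nthCollisionTimeOf a n z = t ∧ Φ.nthPartnerOf a n z = p := by
  have hk0 : 0 ≤ (k : ℝ) * stepLen c σ N := mul_nonneg k.cast_nonneg (stepLen_pos hc hσ N).le
  obtain ⟨hew, hep⟩ := (mem_collTriples Φ hz (stepWindow_subset_Icc c σ N k)).1 he
  have hwin : t ∈ collisionTimesOf G3 (hsDiameter σ N) (fun s => Φ.flow s z) a ∩
      Set.Ioc 0 (((k : ℝ) + 1) * stepLen c σ N) :=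
    ⟨⟨p, Or.inl hep⟩, hk0.trans_lt hew.1, hew.2⟩
  obtain ⟨n, hn, hne⟩ := Φ.exists_lt_ncard_nthCollisionTimeOf_eq hz a hwin
  have hpn : Φ.nthPartnerOf a n z = p := Φ.nthPartnerOf_eq hz (by rw [hne]; exact hep)
  exact ⟨n, (mem_winIdx Φ).2 ⟨hn, by rw [hne]; exact hew.1⟩, hne, hpn⟩

/-- Listed indices are told apart by their collision times (`strictMonoOn_nthCollisionTimeOf_window`). [folklore] -/
theorem eq_of_nthCollisionTimeOf_eq (hz : z ∈ Φ.good) {c : ℝ} {k : ℕ} {a : Fin (N + 1)} {n n' : ℕ}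
    (hn : n ∈ winIdx c σ N Φ k a z) (hn' : n' ∈ winIdx c σ N Φ k a z)
    (h : Φ.nthCollisionTimeOf a n z = Φ.nthCollisionTimeOf a n' z) : n = n' :=
  (Φ.strictMonoOn_nthCollisionTimeOf_window hz a (((k : ℝ) + 1) * stepLen c σ N)).injOn
    ((mem_winIdx Φ).1 hn).1 ((mem_winIdx Φ).1 hn').1 h

/-- **The position of a listed collision**: for `n ∈ winIdx … a z`, `winPos a t_n z` is inside the list and the index
there is `n`. [folklore] -/
theorem winPos_spec (hz : z ∈ Φ.good) {c : ℝ} {k : ℕ} {a : Fin (N + 1)} {n : ℕ} (hn : n ∈ winIdx c σ N Φ k a z) :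
    ∃ h : winPos c σ N Φ k a (Φ.nthCollisionTimeOf a n z) z < (winIdx c σ N Φ k a z).length,
      (winIdx c σ N Φ k a z)[winPos c σ N Φ k a (Φ.nthCollisionTimeOf a n z) z] = n := by
  have hex : ∃ x ∈ winIdx c σ N Φ k a z,
      (fun m => decide (Φ.nthCollisionTimeOf a m z = Φ.nthCollisionTimeOf a n z)) x = true :=
    ⟨n, hn, by simp⟩
  have hlt : winPos c σ N Φ k a (Φ.nthCollisionTimeOf a n z) z < (winIdx c σ N Φ k a z).length :=
    List.findIdx_lt_length_of_exists hex
  have hp := List.findIdx_getElem (xs := winIdx c σ N Φ k a z)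
    (p := fun m => decide (Φ.nthCollisionTimeOf a m z = Φ.nthCollisionTimeOf a n z)) (w := hlt)
  simp only [decide_eq_true_eq] at hp
  exact ⟨hlt, eq_of_nthCollisionTimeOf_eq Φ hz (List.getElem_mem hlt) hn hp⟩

/-- Positions are recovered from the listed times (no duplicates). [folklore] -/
theorem winPos_eq_of_lt (hz : z ∈ Φ.good) {c : ℝ} {k : ℕ} {a : Fin (N + 1)} {ℓ : ℕ}
    (hℓ : ℓ < (winIdx c σ N Φ k a z).length) :
    winPos c σ N Φ k a (Φ.nthCollisionTimeOf a ((winIdx c σ N Φ k a z)[ℓ]) z) z = ℓ := by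
  obtain ⟨h, heq⟩ := winPos_spec Φ hz (List.getElem_mem hℓ)
  exact (List.nodup_range.filter _).getElem_inj_iff.1 heq

/-- Inside the list `winTime` is the time of the listed index. [folklore] -/
theorem winTime_eq_of_lt {c : ℝ} {k : ℕ} {a : Fin (N + 1)} {ℓ : ℕ} (z : Phase N)
    (hℓ : ℓ < (winIdx c σ N Φ k a z).length) :
    winTime c σ N Φ k a ℓ z = Φ.nthCollisionTimeOf a ((winIdx c σ N Φ k a z)[ℓ]) z := by
  rw [winTime, List.getD_eq_getElem?_getD, List.getElem?_eq_getElem hℓ, Option.getD_some]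

/-- `winTime ∘ winPos` is the identity on the step-`k` collision times of `a`. [folklore] -/
theorem winTime_winPos (hz : z ∈ Φ.good) {c : ℝ} (hc : 0 < c) (hσ : 0 < σ) {k : ℕ} {a p : Fin (N + 1)} {t : ℝ}
    (he : (t, a, p) ∈ collTriples Φ (stepWindow c σ N k) z) :
    winTime c σ N Φ k a (winPos c σ N Φ k a t z) z = t := by
  obtain ⟨n, hn, hnt, -⟩ := exists_mem_winIdx Φ hz hc hσ he
  subst hnt
  obtain ⟨hlt, heq⟩ := winPos_spec Φ hz hn
  rw [winTime_eq_of_lt Φ z hlt, heq]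

end Window

/-! ## Equal atoms: equal record lists of the spheres starting in `q` -/

section Atom

variable {σ : ℝ} {N : ℕ} (Φ : Flow σ N) {b c : ℝ} {k : ℕ} {q : Cell} {z z' : Phase N}

/-- On one `seqHistLE k q`-atom of the good set, a sphere starting the step in `q` has the same step-`k` record list
(`jumps (k + 1)`, the second component of the revealed `obs (k + 1)`; a sphere starting in `q` is not strictly above `q`).
[folklore] -/
theorem jumps_eq_of_seqHistLE_eq (hz : z ∈ Φ.good) (hz' : z' ∈ Φ.good)
    (hH : seqHistLE b c σ N Φ k q z' = seqHistLE b c σ N Φ k q z) {a : Fin (N + 1)} (ha : startCell c σ N Φ k z a = q) :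
    jumps b c σ N Φ (k + 1) a z' = jumps b c σ N Φ (k + 1) a z := by
  have h1 := congrFun (congrArg Prod.fst hH) (Fin.last k)
  have h2 := congrFun (congrArg Prod.snd hH) a
  have hk : obs b c σ N Φ k z' = obs b c σ N Φ k z := by
    simp only [seqHistLE, hist, Fin.val_last] at h1
    exact h1
  have hobs1 : (obs b c σ N Φ k z a).1.1 = q := by
    simp only [obs, hz, if_true]
    exact ha
  simp only [seqHistLE] at h2
  rw [hk, hobs1, if_neg (cellLT_irrefl q), if_neg (cellLT_irrefl q)] at h2
  have h3 := congrArg Prod.snd (Option.some_injective _ h2)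
  simp only [obs, hz, hz', if_true] at h3
  exact h3

/-- Hence equal mapped index lists. [folklore] -/
theorem map_winRecord_eq (hz : z ∈ Φ.good) (hz' : z' ∈ Φ.good)
    (hH : seqHistLE b c σ N Φ k q z' = seqHistLE b c σ N Φ k q z) {a : Fin (N + 1)} (ha : startCell c σ N Φ k z a = q) :
    (winIdx c σ N Φ k a z').map (winRecord b Φ a z') = (winIdx c σ N Φ k a z).map (winRecord b Φ a z) := by
  rw [← jumps_succ_eq_map, ← jumps_succ_eq_map]
  exact jumps_eq_of_seqHistLE_eq Φ hz hz' hH ha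

/-- Hence index lists of equal length and position-wise equal reduced records. [folklore] -/
theorem winRecord_getElem_eq (hz : z ∈ Φ.good) (hz' : z' ∈ Φ.good)
    (hH : seqHistLE b c σ N Φ k q z' = seqHistLE b c σ N Φ k q z) {a : Fin (N + 1)} (ha : startCell c σ N Φ k z a = q)
    {ℓ : ℕ} (hℓ : ℓ < (winIdx c σ N Φ k a z).length) :
    ∃ hℓ' : ℓ < (winIdx c σ N Φ k a z').length,
      winRecord b Φ a z' ((winIdx c σ N Φ k a z')[ℓ]) = winRecord b Φ a z ((winIdx c σ N Φ k a z)[ℓ]) := by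
  have hmap := map_winRecord_eq Φ hz hz' hH ha
  have hlen := congrArg List.length hmap
  rw [List.length_map, List.length_map] at hlen
  have h := List.getElem_of_eq hmap (i := ℓ) (by rw [List.length_map, hlen]; exact hℓ)
  rw [List.getElem_map, List.getElem_map] at h
  exact ⟨by rw [hlen]; exact hℓ, h⟩

/-- **Transfer of one collision along the atom.** On one `seqHistLE k q`-atom of the good set (`0 < c`, `0 < σ < 1/2`), for a
sphere `a` starting in `q` and a step-`k` collision triple `(t, a, p)` of `z`, the equally-positioned step-`k` collision of `a`
in `z'`, at time `t' = winTime a (winPos a t z) z'`, is a collision triple `(t', a, p)` of `z'` with the SAME partner, at the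
same position, with the same bins of `a`'s pre-velocity, of `p`'s pre-velocity and of `a`'s post-velocity. [folklore] -/
theorem atomTransfer (hσ : 0 < σ) (hσ2 : σ < 2⁻¹) (hc : 0 < c) (hz : z ∈ Φ.good) (hz' : z' ∈ Φ.good)
    (hH : seqHistLE b c σ N Φ k q z' = seqHistLE b c σ N Φ k q z) {a p : Fin (N + 1)} {t : ℝ}
    (ha : startCell c σ N Φ k z a = q) (he : (t, a, p) ∈ collTriples Φ (stepWindow c σ N k) z) :
    (winTime c σ N Φ k a (winPos c σ N Φ k a t z) z', a, p) ∈ collTriples Φ (stepWindow c σ N k) z' ∧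
      winPos c σ N Φ k a (winTime c σ N Φ k a (winPos c σ N Φ k a t z) z') z' = winPos c σ N Φ k a t z ∧
      velBin b (markOf N (hsDiameter σ N) (Φ.flow (winTime c σ N Φ k a (winPos c σ N Φ k a t z) z') z') a p).2.1 =
        velBin b (markOf N (hsDiameter σ N) (Φ.flow t z) a p).2.1 ∧
      velBin b (markOf N (hsDiameter σ N) (Φ.flow (winTime c σ N Φ k a (winPos c σ N Φ k a t z) z') z') a p).2.2 =
        velBin b (markOf N (hsDiameter σ N) (Φ.flow t z) a p).2.2 ∧
      velBin b ((Φ.flow (winTime c σ N Φ k a (winPos c σ N Φ k a t z) z') z') a).2 = velBin b ((Φ.flow t z) a).2 := by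
  obtain ⟨n, hn, hnt, hnp⟩ := exists_mem_winIdx Φ hz hc hσ he
  subst hnt hnp
  obtain ⟨hlt, hLn⟩ := winPos_spec Φ hz hn
  -- the corresponding index of `z'` and its reduced record
  obtain ⟨hlt', hrec⟩ := winRecord_getElem_eq Φ hz hz' hH ha hlt
  obtain ⟨n', hn'⟩ : ∃ n', (winIdx c σ N Φ k a z')[winPos c σ N Φ k a (Φ.nthCollisionTimeOf a n z) z] = n' := ⟨_, rfl⟩
  have hn'mem : n' ∈ winIdx c σ N Φ k a z' := by rw [← hn']; exact List.getElem_mem hlt'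
  have htime : winTime c σ N Φ k a (winPos c σ N Φ k a (Φ.nthCollisionTimeOf a n z) z) z' =
      Φ.nthCollisionTimeOf a n' z' := by
    rw [winTime_eq_of_lt Φ z' hlt', hn']
  rw [hn', hLn] at hrec
  simp only [winRecord, Prod.mk.injEq] at hrec
  obtain ⟨hpart, hpre1, hpost, hpre2⟩ := hrec
  rw [nthRecordOf_preVel_eq, nthRecordOf_preVel_eq, hpart] at hpre1 hpre2
  rw [htime]
  refine ⟨?_, ?_, hpre1, hpre2, hpost⟩
  · have h := mem_collTriples_of_mem_winIdx Φ hz' hσ hσ2 c hn'mem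
    rw [hpart] at h
    exact h
  · rw [← hn']
    exact winPos_eq_of_lt Φ hz' hlt'

end Atom

/-! ## The map `Θ` and the registered stub -/

/-- The member of the labelled pair `e.2 = (i, j)` that starts the step in `q`, canonically: `i` if it does, else `j`. -/
def qMember (c σ : ℝ) (N : ℕ) (Φ : Flow σ N) (k : ℕ) (q : Cell) (z : Phase N) (e : ℝ × Fin (N + 1) × Fin (N + 1)) :
    Fin (N + 1) :=
  if startCell c σ N Φ k z e.2.1 = q then e.2.1 else e.2.2

/-- THE MAP `Θ` of the dictionary: `(t, i, j) ↦ (t', i, j)` with `t'` the time of the step-`k` collision of the `q`-member in `z'`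
at the same position as the collision at time `t` in `z`. -/
def atomMap (c σ : ℝ) (N : ℕ) (Φ : Flow σ N) (k : ℕ) (q : Cell) (z z' : Phase N) (e : ℝ × Fin (N + 1) × Fin (N + 1)) :
    ℝ × Fin (N + 1) × Fin (N + 1) :=
  (winTime c σ N Φ k (qMember c σ N Φ k q z e) (winPos c σ N Φ k (qMember c σ N Φ k q z e) e.1 z) z', e.2)

section Map

variable {σ : ℝ} {N : ℕ} (Φ : Flow σ N) {b c : ℝ} {k : ℕ} {q : Cell} {z z' : Phase N}

/-- Momentum bookkeeping of a mark: the kick of the first member is minus the kick of the second,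
`v_i⁺ − v_i⁻ = v_j⁻ − v_j⁺` (`reflectVel_fst_add_reflectVel_snd`). [folklore] -/
theorem kick_fst_eq (ε : ℝ) (w : Phase N) (i j : Fin (N + 1)) :
    (w i).2 - (markOf N ε w i j).2.1 = (markOf N ε w i j).2.2 - (w j).2 := by
  have h := reflectVel_fst_add_reflectVel_snd (G3.sepVec (w i).1 (w j).1) ((w i).2, (w j).2)
  change (markOf N ε w i j).2.1 + (markOf N ε w i j).2.2 = (w i).2 + (w j).2 at h
  rw [sub_eq_sub_iff_add_eq_add, ← h, add_comm]

/-- Differences of differences: `‖(a − u) − (a' − u')‖ ≤ ‖a − a'‖ + ‖u − u'‖`. [folklore] -/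
theorem norm_sub_sub_sub_le {a a' u u' : V3} {x y : ℝ} (ha : ‖a - a'‖ ≤ x) (hu : ‖u - u'‖ ≤ y) :
    ‖(a - u) - (a' - u')‖ ≤ x + y :=
  calc ‖(a - u) - (a' - u')‖ = ‖(a - a') - (u - u')‖ := by congr 1; abel
    _ ≤ ‖a - a'‖ + ‖u - u'‖ := norm_sub_le _ _
    _ ≤ x + y := add_le_add ha hu

/-- **Properties of `Θ` on one owned triple.** On one `seqHistLE k q`-atom of the good set (`0 < σ < 1/2`, `0 < c`, `0 < b`),
for a `q`-owned step-`k` collision triple `(t, i, j)` of `z`: `Θ (t, i, j)` is a step-`k` collision triple of `z'` owned by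
`q`, at the same position in the `q`-member's list, position-then-time recovers `t`, the pre-collisional velocities of both
members are `2b`-close and the kicks of the first member `4b`-close (first-slot case directly; second-slot case through
`markOf_swap` and `kick_fst_eq`). [folklore] -/
theorem atomMap_spec (hσ : 0 < σ) (hσ2 : σ < 2⁻¹) (hc : 0 < c) (hb : 0 < b) (hz : z ∈ Φ.good) (hz' : z' ∈ Φ.good)
    (hH : seqHistLE b c σ N Φ k q z' = seqHistLE b c σ N Φ k q z) {t : ℝ} {i j : Fin (N + 1)}
    (he : (t, i, j) ∈ collTriples Φ (stepWindow c σ N k) z)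
    (hq : cellMin (startCell c σ N Φ k z i) (startCell c σ N Φ k z j) = q) :
    atomMap c σ N Φ k q z z' (t, i, j) ∈ collTriples Φ (stepWindow c σ N k) z' ∧
      cellMin (startCell c σ N Φ k z' i) (startCell c σ N Φ k z' j) = q ∧
      winPos c σ N Φ k (qMember c σ N Φ k q z (t, i, j)) (atomMap c σ N Φ k q z z' (t, i, j)).1 z' =
        winPos c σ N Φ k (qMember c σ N Φ k q z (t, i, j)) t z ∧
      winTime c σ N Φ k (qMember c σ N Φ k q z (t, i, j)) (winPos c σ N Φ k (qMember c σ N Φ k q z (t, i, j)) t z) z = t ∧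
      ‖(markOf N (hsDiameter σ N) (Φ.flow t z) i j).2.1 -
          (markOf N (hsDiameter σ N) (Φ.flow (atomMap c σ N Φ k q z z' (t, i, j)).1 z') i j).2.1‖ ≤ 2 * b ∧
      ‖(markOf N (hsDiameter σ N) (Φ.flow t z) i j).2.2 -
          (markOf N (hsDiameter σ N) (Φ.flow (atomMap c σ N Φ k q z z' (t, i, j)).1 z') i j).2.2‖ ≤ 2 * b ∧
      ‖(((Φ.flow t z) i).2 - (markOf N (hsDiameter σ N) (Φ.flow t z) i j).2.1) -
          (((Φ.flow (atomMap c σ N Φ k q z z' (t, i, j)).1 z') i).2 -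
            (markOf N (hsDiameter σ N) (Φ.flow (atomMap c σ N Φ k q z z' (t, i, j)).1 z') i j).2.1)‖ ≤ 2 * (2 * b) := by
  have hcell := (startCell_eq_and_norm_sub_le_of_seqHistLE_eq Φ hb c k q hz hz' hH).1
  have hε : hsDiameter σ N < 2⁻¹ := (hsDiameter_le hσ.le N).trans_lt hσ2
  have hW := stepWindow_subset_Icc c σ N k
  have hp : (i, j) ∈ contactPairs G3 (hsDiameter σ N) (Φ.flow t z) := ((mem_collTriples Φ hz hW).1 he).2
  have hown' : cellMin (startCell c σ N Φ k z' i) (startCell c σ N Φ k z' j) = q := by rw [hcell, hcell]; exact hq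
  have h4b : 2 * b + 2 * b = 2 * (2 * b) := by ring
  by_cases hi : startCell c σ N Φ k z i = q
  · -- the `q`-member is the first slot
    have hm : qMember c σ N Φ k q z (t, i, j) = i := if_pos hi
    simp only [atomMap, hm]
    obtain ⟨hmem, hpos, hv1, hv2, hv3⟩ := atomTransfer Φ hσ hσ2 hc hz hz' hH hi he
    have h1 := norm_sub_le_of_velBin_eq hb hv1.symm
    exact ⟨hmem, hown', hpos, winTime_winPos Φ hz hc hσ he, h1, norm_sub_le_of_velBin_eq hb hv2.symm,
      h4b ▸ norm_sub_sub_sub_le (norm_sub_le_of_velBin_eq hb hv3.symm) h1⟩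
  · -- the `q`-member is the second slot
    have hj : startCell c σ N Φ k z j = q := by
      unfold cellMin at hq
      split_ifs at hq with h
      · exact hq
      · exact absurd hq hi
    have hm : qMember c σ N Φ k q z (t, i, j) = j := if_neg hi
    simp only [atomMap, hm]
    have he' : (t, j, i) ∈ collTriples Φ (stepWindow c σ N k) z := (swap_mem_collTriples Φ hz hW hε (e := (t, i, j))).2 he
    obtain ⟨hmem, hpos, hv1, hv2, hv3⟩ := atomTransfer Φ hσ hσ2 hc hz hz' hH hj he'
    obtain ⟨t', ht'⟩ : ∃ t', winTime c σ N Φ k j (winPos c σ N Φ k j t z) z' = t' := ⟨_, rfl⟩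
    rw [ht'] at hmem hpos hv1 hv2 hv3 ⊢
    have hmem' : (t', i, j) ∈ collTriples Φ (stepWindow c σ N k) z' :=
      (swap_mem_collTriples Φ hz' hW hε (e := (t', i, j))).1 hmem
    have hp' : (i, j) ∈ contactPairs G3 (hsDiameter σ N) (Φ.flow t' z') := ((mem_collTriples Φ hz' hW).1 hmem').2
    -- the swapped marks: pre-velocities exchanged
    rw [markOf_swap hσ hσ2 hp, markOf_swap hσ hσ2 hp'] at hv1 hv2
    dsimp only at hv1 hv2
    have h2 := norm_sub_le_of_velBin_eq hb hv1.symm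
    refine ⟨hmem', hown', hpos, winTime_winPos Φ hz hc hσ he', norm_sub_le_of_velBin_eq hb hv2.symm, h2, ?_⟩
    rw [kick_fst_eq, kick_fst_eq]
    exact h4b ▸ norm_sub_sub_sub_le h2 (norm_sub_le_of_velBin_eq hb hv3.symm)

/-- **Registered stub S8b `stub_atomCollisionDictionary`: the collision half of the revealed-atom dictionary.** For two good
phase points of one `seqHistLE b c σ N Φ k q`-atom (`0 < σ < 1/2`, `0 < c`, `0 < b`) the map `atomMap` is a bijection from
the `q`-owned collision triples of step `k` of `z` onto those of `z'` (`atomMap_spec`: maps to; injective — same labels and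
same position in the `q`-member's list give the same time, `winTime_winPos`; surjective — the same construction from `z'`
back to `z`, `seqHistLE` being equal both ways), preserving the ordered labels, with `2b`-close pre-collisional velocities
and `4b`-close kicks. [folklore] -/
theorem stub_atomCollisionDictionary : AtomCollisionDictionary := by
  intro σ N Φ b c k q z z' hσ hσ2 hc hb hz hz' hH
  have hcell := (startCell_eq_and_norm_sub_le_of_seqHistLE_eq Φ hb c k q hz hz' hH).1
  refine ⟨atomMap c σ N Φ k q z z', ⟨?_, ?_, ?_⟩, ?_⟩
  · -- maps owned triples to owned triples
    rintro ⟨t, i, j⟩ ⟨he, hq⟩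
    obtain ⟨hmem, hown, -⟩ := atomMap_spec Φ hσ hσ2 hc hb hz hz' hH he hq
    exact ⟨hmem, hown⟩
  · -- injective: same labels, same position, same time
    rintro ⟨t₁, i₁, j₁⟩ ⟨he₁, hq₁⟩ ⟨t₂, i₂, j₂⟩ ⟨he₂, hq₂⟩ hΘ
    have h2 := congrArg Prod.snd hΘ
    change ((i₁, j₁) : Fin (N + 1) × Fin (N + 1)) = (i₂, j₂) at h2
    simp only [Prod.mk.injEq] at h2
    obtain ⟨rfl, rfl⟩ := h2
    have h1 : (atomMap c σ N Φ k q z z' (t₁, i₁, j₁)).1 = (atomMap c σ N Φ k q z z' (t₂, i₁, j₁)).1 := congrArg Prod.fst hΘ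
    obtain ⟨-, -, hpos₁, hfix₁, -⟩ := atomMap_spec Φ hσ hσ2 hc hb hz hz' hH he₁ hq₁
    obtain ⟨-, -, hpos₂, hfix₂, -⟩ := atomMap_spec Φ hσ hσ2 hc hb hz hz' hH he₂ hq₂
    have hm : qMember c σ N Φ k q z (t₁, i₁, j₁) = qMember c σ N Φ k q z (t₂, i₁, j₁) := rfl
    rw [hm, h1, hpos₂] at hpos₁
    rw [hm, ← hpos₁, hfix₂] at hfix₁
    rw [hfix₁]
  · -- surjective: the same construction from `z'` back to `z`
    rintro ⟨t', i, j⟩ ⟨he', hq'⟩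
    obtain ⟨hmem, hown, hpos, hfix, -⟩ := atomMap_spec Φ hσ hσ2 hc hb hz' hz hH.symm he' hq'
    refine ⟨atomMap c σ N Φ k q z' z (t', i, j), ⟨hmem, hown⟩, ?_⟩
    have hm : qMember c σ N Φ k q z (atomMap c σ N Φ k q z' z (t', i, j)) = qMember c σ N Φ k q z' (t', i, j) := by
      simp only [qMember, atomMap, hcell]
    show (winTime c σ N Φ k (qMember c σ N Φ k q z (atomMap c σ N Φ k q z' z (t', i, j)))
        (winPos c σ N Φ k (qMember c σ N Φ k q z (atomMap c σ N Φ k q z' z (t', i, j)))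
          (atomMap c σ N Φ k q z' z (t', i, j)).1 z) z', (atomMap c σ N Φ k q z' z (t', i, j)).2) = (t', i, j)
    rw [hm, hpos, hfix]
    rfl
  · -- labels and closeness
    rintro ⟨t, i, j⟩ he hq
    obtain ⟨-, -, -, -, h1, h2, h3⟩ := atomMap_spec Φ hσ hσ2 hc hb hz hz' hH he hq
    exact ⟨rfl, h1, h2, h3⟩

end Map

end Summit.AtomisticToContinuum.HydrodynamicLimit.Theorems.EquilibriumForecastLine

end
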